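import Literature.Algebra.Homology.DiscreteRepLayerColimitLemmas
import Literature.Algebra.Homology.RepExtFiniteGroupDirectedUnion
import HarnessLib

/-!
# `Extⁿ_{C_Γ}(k, M) = lim→_U Extⁿ_{Rep k (Γ⧸U)}(k, M^U)` over the open normal subgroups of a profinite
# group — Serre's `H^q(G, A) = lim→ H^q(G/U, A^U)` in all degrees, on `Ext`, by dimension shifting

Topic `Algebra/Homology`; namespace `Literature.Algebra.Homology.DiscreteRep.LayerColimit`.  Two
auxiliary definitions with bodies (`toLayerX₃`, `resX₃`: restricted layer classes with a syntactically
clean type) and theorems; no named fact, no instance, no `sorry`.  Sequel of `DiscreteRepLayerColimitSetup`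
/ `DiscreteRepLayerColimitLemmas` (door-c4 g14) and `RepExtFiniteGroupDirectedUnion` (finite groups:
`Ext_{Rep k G}(k, –)` commutes with directed unions).  Written for Route A of the Poitou–Tate programme
of crux `stmt-BirchSwinnertonDyer-19295` (cell `bsd-schneider-ideate`, seat door-c4 gen 14): item (d)
of FINDING-door-c4-g13/g14 — the passage from the cell's FINITE-LAYER theorems (class modules,
fundamental classes, Tate–Nakayama, Milne I Lemma 1.9's `(U:V)·Inf` vanishing, all in
`Rep ℤ Gal(E/F)` / `groupCohomology`) to the profinite group `Γ_K` (the limit objects `C̄`, `J̄`).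

THE STATEMENT IN PRINT.  Serre, *Galois Cohomology* I §2.2 Prop. 8: for `G` profinite and `A` a
discrete `G`-module, `H^q(G, A) = lim→ H^q(G/U, A^U)` over the open normal subgroups `U`; Harari,
*Galois Cohomology and Class Field Theory*, Prop. 4.18 / Remark 4.24 (derived functors of `A ↦ A^G` on
`C_G`, computed through the `I^U`, injective in `C_{G/U}`).  Here `H^q(G, ·) := Ext^q_{C_Γ}(k, ·)`
(Mathlib's `Abelian.Ext` in `DiscreteRepCat k Γ`; = continuous cochain cohomology by
`DiscreteRepStandardResolution`) and `H^q(G/U, A^U) := Ext^q_{Rep k (Γ⧸U)}(k, A^U)` (= Mathlib's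
`groupCohomology` by `RepExtGroupCohomology`), the maps of the direct system being
`extInf U : Ext(k, M^U) → Ext(k, M)` (`DiscreteRepLayerInflation`) and `extInfStep U V`
(`DiscreteRepLayerTransition`).  The colimit is stated ELEMENTWISE:

* **`exists_infl_eq`** (surjectivity): every `x ∈ Extⁿ_{C_Γ}(k, M)` is `extInf_U y` for some open
  normal `U` and `y ∈ Extⁿ_{Rep k (Γ⧸U)}(k, M^U)`;
* **`exists_step_eq_zero`** (injectivity): if `extInf_U y = 0` then `extInfStep U V y = 0` for some
  open normal `V ≤ U`; in degrees `0` and `1` already `y = 0` (`extInf_zero_injective`, `injective_infl_one`);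
* **`ext_eq_zero_of_forall_exists_step_eq_zero`**: if every layer class dies at some deeper layer then
  `Extⁿ_{C_Γ}(k, M) = 0` (the shape of Milne I Lemma 1.9 (b) / Harari Lemma 16.20).

PROOF (no cochains): induction on the degree simultaneously for all `M`, by dimension shifting along
Mathlib's injective presentation `0 → M → I → Q → 0` in `C_Γ` and the layer sequences
`0 → M^U → I^U → liftable_U → 0` (`I^U` injective in `Rep k (Γ⧸U)`, Harari Rem. 4.24), using:
every vector of the discrete `I` is invariant under some open normal `V` (so every class of `Q^U`
becomes liftable at a deeper layer), and — for the finite groups `Γ⧸U` (profinite `Γ`) — the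
commutation of `Ext_{Rep k (Γ⧸U)}(k, ·)` with the directed union `Q^U = ⋃_W liftable_{U,W}`
(`RepExt.exists_comp_mk₀_eq(_zero)_of_directed`).

HONEST FRAMING: homological algebra only; no arithmetic statement and no case of BSD is proved here.

## References
* J.-P. Serre, *Galois Cohomology*, Springer (1997), I §2.2 Proposition 8. [SerreGaloisCohomology1997]
* D. Harari, *Galois Cohomology and Class Field Theory*, Universitext, Springer (2020), §4.3
  Proposition 4.18 and Remark 4.24 (p. 95). [Harari2020]
-/

noncomputable section

universe u

namespace Literature.Algebra.Homology

namespace DiscreteRep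

namespace LayerColimit

open CategoryTheory CategoryTheory.Limits CategoryTheory.Abelian Representation

variable {k Γ : Type u} [CommRing k] [Group Γ] [TopologicalSpace Γ] [IsTopologicalGroup Γ]
  [CompactSpace Γ] [TotallyDisconnectedSpace Γ]

omit [IsTopologicalGroup Γ] [CompactSpace Γ] [TotallyDisconnectedSpace Γ] in
/-- The order on open normal subgroups implies the order on the underlying subgroups.
[cite: SerreGaloisCohomology1997, I §2.2 Proposition 8] -/
theorem coe_le_coe_of_le {V U : OpenNormalSubgroup Γ} (h : V ≤ U) : (V : Subgroup Γ) ≤ U :=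
  fun _ hx => h hx

/-! ## §0 Restriction of layer classes, with syntactically clean types

`Ext.mapExactFunctor (layerRes …)` produces classes out of `(layerRes …).obj (Rep.trivial …)`, which
is the trivial representation only up to (non-reducible) definitional unfolding; the two wrappers
below have the trivial representation of the deeper layer as their declared source, so that the
rewriting lemmas of this file match syntactically. -/

section Clean

omit [CompactSpace Γ] [TotallyDisconnectedSpace Γ]

variable (M : DiscreteRepCat k Γ) (U W : OpenNormalSubgroup Γ) (hWU : (W : Subgroup Γ) ≤ U)

/-- **`Res_{UW}(w) ≫ toLayer`**: a class of `Extⁿ_{Γ⧸U}(k, liftable M U W)` restricted to the layer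
`W`, with values in the third term `liftable M W W` of the layer sequence of `W`.
[cite: SerreGaloisCohomology1997, I §2.2 Proposition 8] -/
def toLayerX₃ {n : ℕ}
    (w : Ext (Rep.trivial k (Γ ⧸ (U : Subgroup Γ)) k) (liftable M (U : Subgroup Γ) (W : Subgroup Γ)) n) :
    Ext (Rep.trivial k (Γ ⧸ (W : Subgroup Γ)) k) (layerSC M (W : Subgroup Γ)).X₃ n :=
  (w.mapExactFunctor (layerRes k (U : Subgroup Γ) (W : Subgroup Γ) hWU)).comp
    (Ext.mk₀ (liftableToLayer M (U : Subgroup Γ) (W : Subgroup Γ) hWU)) (add_zero n)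

/-- `toLayerX₃` of `0` is `0`. [cite: SerreGaloisCohomology1997, I §2.2 Proposition 8] -/
theorem toLayerX₃_zero (n : ℕ) :
    toLayerX₃ M U W hWU
      (0 : Ext (Rep.trivial k (Γ ⧸ (U : Subgroup Γ)) k) (liftable M (U : Subgroup Γ) (W : Subgroup Γ)) n) = 0 := by
  change ((0 : Ext (Rep.trivial k (Γ ⧸ (U : Subgroup Γ)) k) (liftable M (U : Subgroup Γ) (W : Subgroup Γ))
    n).mapExactFunctor (layerRes k (U : Subgroup Γ) (W : Subgroup Γ) hWU)).comp
    (Ext.mk₀ (liftableToLayer M (U : Subgroup Γ) (W : Subgroup Γ) hWU)) (add_zero n) = 0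
  rw [Ext.mapExactFunctor_zero, Ext.zero_comp]

/-- **`extInf_W ((toLayerX₃ w) ≫ incl_W) = extInf_U (w ≫ incl_{U,W})` in `Extⁿ_{C_Γ}(k, Q)`** (change of
layer under inflation). [cite: SerreGaloisCohomology1997, I §2.2 Proposition 8] -/
theorem infl_toLayerX₃_comp_incl {n : ℕ}
    (w : Ext (Rep.trivial k (Γ ⧸ (U : Subgroup Γ)) k) (liftable M (U : Subgroup Γ) (W : Subgroup Γ)) n) :
    infl W (presQ M) n ((toLayerX₃ M U W hWU w).comp
        (Ext.mk₀ (liftableIncl M (W : Subgroup Γ) (W : Subgroup Γ))) (add_zero n)) =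
      infl U (presQ M) n (w.comp (Ext.mk₀ (liftableIncl M (U : Subgroup Γ) (W : Subgroup Γ))) (add_zero n)) :=
  extInf_layerRes_comp (U : Subgroup Γ) (W : Subgroup Γ) (coe_isOpen U) (coe_isOpen W) hWU (presQ M)
    (liftableIncl M (U : Subgroup Γ) (W : Subgroup Γ)) (liftableIncl M (W : Subgroup Γ) (W : Subgroup Γ))
    (liftableToLayer M (U : Subgroup Γ) (W : Subgroup Γ) hWU)
    (liftableToLayer_comp_incl M (U : Subgroup Γ) (W : Subgroup Γ) hWU) w

/-- **`Res_{UW}(w) ≫ τ₃`**: a class of `Extⁿ_{Γ⧸U}(k, liftable M U U)` pushed to the third term of the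
layer sequence of `W` along the morphism of layer sequences `layerSCStep`.
[cite: SerreGaloisCohomology1997, I §2.2 Proposition 8] -/
def resX₃ {n : ℕ} (w : Ext (Rep.trivial k (Γ ⧸ (U : Subgroup Γ)) k) (layerSC M (U : Subgroup Γ)).X₃ n) :
    Ext (Rep.trivial k (Γ ⧸ (W : Subgroup Γ)) k) (layerSC M (W : Subgroup Γ)).X₃ n :=
  (w.mapExactFunctor (layerRes k (U : Subgroup Γ) (W : Subgroup Γ) hWU)).comp
    (Ext.mk₀ (layerSCStep M (U : Subgroup Γ) (W : Subgroup Γ) hWU).τ₃) (add_zero n)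

/-- `resX₃ w = toLayerX₃ (w ≫ liftableMono)`. [cite: SerreGaloisCohomology1997, I §2.2 Proposition 8] -/
theorem resX₃_eq {n : ℕ} (w : Ext (Rep.trivial k (Γ ⧸ (U : Subgroup Γ)) k) (layerSC M (U : Subgroup Γ)).X₃ n) :
    resX₃ M U W hWU w =
      toLayerX₃ M U W hWU (w.comp (Ext.mk₀ (liftableMono M (U : Subgroup Γ) hWU)) (add_zero n)) := by
  change (w.mapExactFunctor (layerRes k (U : Subgroup Γ) (W : Subgroup Γ) hWU)).comp
      (Ext.mk₀ (layerSCStep M (U : Subgroup Γ) (W : Subgroup Γ) hWU).τ₃) (add_zero n) =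
    ((w.comp (Ext.mk₀ (liftableMono M (U : Subgroup Γ) hWU)) (add_zero n)).mapExactFunctor
      (layerRes k (U : Subgroup Γ) (W : Subgroup Γ) hWU)).comp
      (Ext.mk₀ (liftableToLayer M (U : Subgroup Γ) (W : Subgroup Γ) hWU)) (add_zero n)
  rw [layerSCStep_τ₃, ← Ext.mk₀_comp_mk₀, Ext.mapExactFunctor_comp, Ext.mapExactFunctor_mk₀,
    Ext.comp_assoc_of_second_deg_zero]

/-- **`(resX₃ w) ≫ incl_W = t_{UW}(w ≫ incl_U)` in `Extⁿ_{Γ⧸W}(k, Q^W)`.**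
[cite: SerreGaloisCohomology1997, I §2.2 Proposition 8] -/
theorem resX₃_comp_incl {n : ℕ}
    (w : Ext (Rep.trivial k (Γ ⧸ (U : Subgroup Γ)) k) (layerSC M (U : Subgroup Γ)).X₃ n) :
    (resX₃ M U W hWU w).comp (Ext.mk₀ (liftableIncl M (W : Subgroup Γ) (W : Subgroup Γ))) (add_zero n) =
      step U W hWU (presQ M) n
        (w.comp (Ext.mk₀ (liftableIncl M (U : Subgroup Γ) (U : Subgroup Γ))) (add_zero n)) := by
  change ((w.mapExactFunctor (layerRes k (U : Subgroup Γ) (W : Subgroup Γ) hWU)).comp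
      (Ext.mk₀ (layerSCStep M (U : Subgroup Γ) (W : Subgroup Γ) hWU).τ₃) (add_zero n)).comp
      (Ext.mk₀ (liftableIncl M (W : Subgroup Γ) (W : Subgroup Γ))) (add_zero n) =
    ((w.comp (Ext.mk₀ (liftableIncl M (U : Subgroup Γ) (U : Subgroup Γ))) (add_zero n)).mapExactFunctor
      (layerRes k (U : Subgroup Γ) (W : Subgroup Γ) hWU)).comp
      (Ext.mk₀ (invariantsStepIncl (U : Subgroup Γ) (W : Subgroup Γ) hWU (presQ M))) (add_zero n)
  rw [Ext.comp_assoc_of_second_deg_zero, Ext.mk₀_comp_mk₀, Ext.mapExactFunctor_comp,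
    Ext.mapExactFunctor_mk₀, Ext.comp_assoc_of_second_deg_zero, Ext.mk₀_comp_mk₀]
  exact congrArg (fun φ => (w.mapExactFunctor (layerRes k (U : Subgroup Γ) (W : Subgroup Γ) hWU)).comp
    (Ext.mk₀ φ) (add_zero n)) (layerSCStep_τ₃_comp_incl M (U : Subgroup Γ) (W : Subgroup Γ) hWU)

/-- **`extInf_U (y ≫ δ_{S_U}) = extInf_U (y ≫ incl_U) ≫ δ_T`** (compatibility of inflation with the
connecting maps of the layer sequence `S_U` and of the presentation `T`).
[cite: SerreGaloisCohomology1997, I §2.2 Proposition 8][cite: Harari2020, §4.3 Remark 4.24] -/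
theorem infl_comp_extClass {n : ℕ}
    (y : Ext (Rep.trivial k (Γ ⧸ (U : Subgroup Γ)) k) (layerSC M (U : Subgroup Γ)).X₃ n) :
    infl U M (n + 1) (y.comp (layerSC_shortExact M (U : Subgroup Γ)).extClass (rfl : n + 1 = n + 1)) =
      (infl U (presQ M) n (y.comp (Ext.mk₀ (liftableIncl M (U : Subgroup Γ) (U : Subgroup Γ)))
        (add_zero n))).comp (presSC_shortExact M).extClass (rfl : n + 1 = n + 1) := by
  refine (extInf_comp_layer_extClass M (U : Subgroup Γ) (coe_isOpen U) y).trans ?_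
  rw [inf_comp_τ₃_eq_extInf]
  rfl

/-- **`t_{UW} (w ≫ δ_{S_U}) = (resX₃ w) ≫ δ_{S_W}`** (compatibility of the transitions with the
connecting maps of the layer sequences). [cite: SerreGaloisCohomology1997, I §2.2 Proposition 8] -/
theorem step_comp_extClass {n : ℕ}
    (w : Ext (Rep.trivial k (Γ ⧸ (U : Subgroup Γ)) k) (layerSC M (U : Subgroup Γ)).X₃ n) :
    step U W hWU M (n + 1) (w.comp (layerSC_shortExact M (U : Subgroup Γ)).extClass (rfl : n + 1 = n + 1)) =
      (resX₃ M U W hWU w).comp (layerSC_shortExact M (W : Subgroup Γ)).extClass (rfl : n + 1 = n + 1) :=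
  extInfStep_comp_layer_extClass M (U : Subgroup Γ) (W : Subgroup Γ) hWU w

end Clean

/-! ## §1 The directed union `Q^U = ⋃_W liftable M U W` at a finite layer -/

section Finitary

variable (M : DiscreteRepCat k Γ) (U : OpenNormalSubgroup Γ)

/-- **Every class of `Extⁿ_{Γ⧸U}(k, Q^U)` is supported on `liftable M U W` for some open normal `W`**
(the finite group `Γ⧸U` is of type `FP_∞` and the `liftable M U W` form a directed union exhausting
`Q^U`). [cite: SerreGaloisCohomology1997, I §2.2 Proposition 8] -/
theorem exists_liftable_of_ext (n : ℕ)
    (w : Ext (Rep.trivial k (Γ ⧸ (U : Subgroup Γ)) k)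
      ((invariantsQuotFunctor k (U : Subgroup Γ)).obj (presQ M)) n) :
    ∃ (W : OpenNormalSubgroup Γ) (w₀ : Ext (Rep.trivial k (Γ ⧸ (U : Subgroup Γ)) k)
      (liftable M (U : Subgroup Γ) (W : Subgroup Γ)) n),
      w₀.comp (Ext.mk₀ (liftableIncl M (U : Subgroup Γ) (W : Subgroup Γ))) (add_zero n) = w := by
  haveI : Nonempty (OpenNormalSubgroup Γ)ᵒᵈ := ⟨OrderDual.toDual (topOpenNormalSubgroup Γ)⟩
  haveI : Finite (Γ ⧸ (U : Subgroup Γ)) := Subgroup.quotient_finite_of_isOpen _ (coe_isOpen U)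
  obtain ⟨W, w₀, hw₀⟩ := RepExt.exists_comp_mk₀_eq_of_directed (ι := (OpenNormalSubgroup Γ)ᵒᵈ)
    (A := fun W => liftable M (U : Subgroup Γ) ((OrderDual.ofDual W : OpenNormalSubgroup Γ) : Subgroup Γ))
    (fun W => liftableIncl M (U : Subgroup Γ) ((OrderDual.ofDual W : OpenNormalSubgroup Γ) : Subgroup Γ))
    (fun W => liftableIncl_injective M _ _)
    (fun W W' h => liftableMono M (U : Subgroup Γ) (coe_le_coe_of_le (OrderDual.ofDual_le_ofDual.2 h)))
    (fun _ _ _ => liftableMono_comp_incl M _ _ _)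
    (fun q => by
      obtain ⟨W, q', hq'⟩ := exists_mem_liftable M (U : Subgroup Γ) q
      exact ⟨OrderDual.toDual W, q', hq'⟩)
    n w
  exact ⟨OrderDual.ofDual W, w₀, hw₀⟩

/-- **A class of `Extⁿ_{Γ⧸U}(k, liftable M U W₁)` dying in `Q^U` dies in `liftable M U W₂` for some
open normal `W₂ ≤ W₁`.** [cite: SerreGaloisCohomology1997, I §2.2 Proposition 8] -/
theorem exists_liftableMono_eq_zero (n : ℕ) (W₁ : OpenNormalSubgroup Γ)
    (y : Ext (Rep.trivial k (Γ ⧸ (U : Subgroup Γ)) k) (liftable M (U : Subgroup Γ) (W₁ : Subgroup Γ)) n)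
    (hy : y.comp (Ext.mk₀ (liftableIncl M (U : Subgroup Γ) (W₁ : Subgroup Γ))) (add_zero n) = 0) :
    ∃ (W₂ : OpenNormalSubgroup Γ) (h : (W₂ : Subgroup Γ) ≤ W₁),
      y.comp (Ext.mk₀ (liftableMono M (U : Subgroup Γ) h)) (add_zero n) = 0 := by
  haveI : Nonempty (OpenNormalSubgroup Γ)ᵒᵈ := ⟨OrderDual.toDual (topOpenNormalSubgroup Γ)⟩
  haveI : Finite (Γ ⧸ (U : Subgroup Γ)) := Subgroup.quotient_finite_of_isOpen _ (coe_isOpen U)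
  obtain ⟨W₂, h, hW₂⟩ := RepExt.exists_comp_mk₀_eq_zero_of_directed (ι := (OpenNormalSubgroup Γ)ᵒᵈ)
    (A := fun W => liftable M (U : Subgroup Γ) ((OrderDual.ofDual W : OpenNormalSubgroup Γ) : Subgroup Γ))
    (fun W => liftableIncl M (U : Subgroup Γ) ((OrderDual.ofDual W : OpenNormalSubgroup Γ) : Subgroup Γ))
    (fun W => liftableIncl_injective M _ _)
    (fun W W' h => liftableMono M (U : Subgroup Γ) (coe_le_coe_of_le (OrderDual.ofDual_le_ofDual.2 h)))
    (fun _ _ _ => liftableMono_comp_incl M _ _ _)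
    (fun q => by
      obtain ⟨W, q', hq'⟩ := exists_mem_liftable M (U : Subgroup Γ) q
      exact ⟨OrderDual.toDual W, q', hq'⟩)
    n (OrderDual.toDual W₁) y hy
  exact ⟨OrderDual.ofDual W₂, coe_le_coe_of_le (OrderDual.ofDual_le_ofDual.2 h), hW₂⟩

end Finitary

/-! ## §2 Surjectivity: the induction step -/

/-- **Surjectivity, induction step `n ⇒ n + 1`** (dimension shifting: `x = z ≫ δ` with `z ∈ Extⁿ(k, Q)`;
`z` comes from a layer `U`; its layer class is supported on `liftable M U W`; at the layer `W ⊓ U` the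
class `toLayerX₃ (w₀ ≫ mono) ≫ δ_{S}` inflates to `x`). [cite: SerreGaloisCohomology1997, I §2.2 Proposition 8]
[cite: Harari2020, §4.3 Remark 4.24] -/
theorem exists_infl_eq_succ (n : ℕ)
    (ih : ∀ (N : DiscreteRepCat k Γ) (z : Ext (triv (Γ := Γ) k) N n),
      ∃ (U : OpenNormalSubgroup Γ) (y : LExt U N n), infl U N n y = z)
    (M : DiscreteRepCat k Γ) (x : Ext (triv (Γ := Γ) k) M (n + 1)) :
    ∃ (U : OpenNormalSubgroup Γ) (y : LExt U M (n + 1)), infl U M (n + 1) y = x := by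
  have hx0 : x.comp (Ext.mk₀ (presSC M).f) (add_zero _) = 0 := Ext.eq_zero_of_injective _
  obtain ⟨z, rfl⟩ := Ext.covariant_sequence_exact₁ (hS := presSC_shortExact M) _ x hx0 rfl
  obtain ⟨U, w, rfl⟩ := ih (presQ M) z
  obtain ⟨W, w₀, rfl⟩ := exists_liftable_of_ext M U n w
  have hW'U : ((W ⊓ U : OpenNormalSubgroup Γ) : Subgroup Γ) ≤ U := coe_le_coe_of_le inf_le_right
  have hW'W : ((W ⊓ U : OpenNormalSubgroup Γ) : Subgroup Γ) ≤ W := coe_le_coe_of_le inf_le_left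
  refine ⟨W ⊓ U, (toLayerX₃ M U (W ⊓ U) hW'U
      (w₀.comp (Ext.mk₀ (liftableMono M (U : Subgroup Γ) hW'W)) (add_zero n))).comp
      (layerSC_shortExact M ((W ⊓ U : OpenNormalSubgroup Γ) : Subgroup Γ)).extClass
      (rfl : n + 1 = n + 1), ?_⟩
  rw [infl_comp_extClass, infl_toLayerX₃_comp_incl, Ext.comp_assoc_of_second_deg_zero,
    Ext.mk₀_comp_mk₀, liftableMono_comp_incl]

/-! ## §3 Injectivity: degree `1` and the induction step -/

omit [CompactSpace Γ] [TotallyDisconnectedSpace Γ] in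
/-- **Injectivity in degree `1`: `extInf_U` is injective on `Ext¹`** (a class `δ_U w'` dying in
`Ext¹(k, M)` has `w'` coming from `I^Γ ⊆ I^U`, so `δ_U w' = 0`).
[cite: SerreGaloisCohomology1997, I §2.2 Proposition 8][cite: Harari2020, §4.3 Remark 4.24] -/
theorem infl_one_injective (M : DiscreteRepCat k Γ) (U : OpenNormalSubgroup Γ) (y : LExt U M (0 + 1))
    (hy : infl U M (0 + 1) y = 0) : y = 0 := by
  haveI := injective_layer_X₂ M (U : Subgroup Γ) (coe_isOpen U)
  haveI : Mono (liftableIncl M (U : Subgroup Γ) (U : Subgroup Γ)) :=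
    (Rep.mono_iff_injective _).2 (liftableIncl_injective M _ _)
  have hy0 : y.comp (Ext.mk₀ (layerSC M (U : Subgroup Γ)).f) (add_zero (0 + 1)) = 0 :=
    Ext.eq_zero_of_injective _
  obtain ⟨w', rfl⟩ := Ext.covariant_sequence_exact₁ (hS := layerSC_shortExact M (U : Subgroup Γ)) _ y
    hy0 (rfl : 0 + 1 = 0 + 1)
  rw [infl_comp_extClass] at hy
  obtain ⟨v, hv⟩ := Ext.covariant_sequence_exact₃ (hS := presSC_shortExact M) _ _ rfl hy
  obtain ⟨f, rfl⟩ := (Ext.mk₀_bijective _ _).2 v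
  -- the layer class `w' ≫ incl` is `(homToLayer f) ≫ π^U`
  have key : w'.comp (Ext.mk₀ (liftableIncl M (U : Subgroup Γ) (U : Subgroup Γ))) (add_zero 0) =
      (Ext.mk₀ (homToLayer (U : Subgroup Γ) (pres M) f)).comp
        (Ext.mk₀ ((invariantsQuotFunctor k (U : Subgroup Γ)).map (presπ M))) (add_zero 0) := by
    apply extInf_zero_injective (U : Subgroup Γ) (coe_isOpen U) (presQ M)
    rw [Ext.mk₀_comp_mk₀, extInf_mk₀, Functor.map_comp, Category.assoc,
      infFunctor_map_invariantsIncl, ← Category.assoc, infFunctor_map_homToLayer_comp]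
    exact hv.symm.trans (Ext.mk₀_comp_mk₀ f _)
  -- hence `w' = (homToLayer f) ≫ liftableProj`
  have key2 : w' = (Ext.mk₀ (homToLayer (U : Subgroup Γ) (pres M) f)).comp
      (Ext.mk₀ (liftableProj M (U : Subgroup Γ))) (add_zero 0) := by
    apply Ext.postcomp_mk₀_injective_of_mono _ (liftableIncl M (U : Subgroup Γ) (U : Subgroup Γ))
    change w'.comp (Ext.mk₀ (liftableIncl M (U : Subgroup Γ) (U : Subgroup Γ))) (add_zero 0) =
      ((Ext.mk₀ (homToLayer (U : Subgroup Γ) (pres M) f)).comp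
        (Ext.mk₀ (liftableProj M (U : Subgroup Γ))) (add_zero 0)).comp
        (Ext.mk₀ (liftableIncl M (U : Subgroup Γ) (U : Subgroup Γ))) (add_zero 0)
    rw [key]
    simp only [Ext.mk₀_comp_mk₀, Category.assoc, liftableProj_comp_incl]
  rw [key2, Ext.comp_assoc_of_second_deg_zero,
    (layerSC_shortExact M (U : Subgroup Γ)).comp_extClass, Ext.comp_zero]

omit [CompactSpace Γ] [TotallyDisconnectedSpace Γ] in
/-- **`extInf_U : Ext¹_{Γ⧸U}(k, M^U) → Ext¹_{C_Γ}(k, M)` is injective** (inflation–restriction in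
degree `1`). [cite: SerreGaloisCohomology1997, I §2.2 Proposition 8] -/
theorem injective_infl_one (M : DiscreteRepCat k Γ) (U : OpenNormalSubgroup Γ) :
    Function.Injective (infl U M 1) :=
  (injective_iff_map_eq_zero _).2 fun y hy => infl_one_injective M U y hy

/-- **Injectivity, induction step `n + 1 ⇒ n + 2`** (`y = δ_U w'`; `Inf(w' ≫ incl)` dies in
`Extⁿ⁺¹(k, Q)` because `Extⁿ⁺¹(k, I) = 0`; by induction `w' ≫ incl` dies at a layer `V`; there the
class `resX₃ w'` dies in `Q^V`, hence in `liftable M V W₂` for a deeper `W₂`; so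
`t_{U W₂} y = δ_{W₂}(0) = 0`). [cite: SerreGaloisCohomology1997, I §2.2 Proposition 8][cite: Harari2020, §4.3 Remark 4.24] -/
theorem exists_step_eq_zero_succ_succ (n : ℕ)
    (ih : ∀ (N : DiscreteRepCat k Γ) (U : OpenNormalSubgroup Γ) (w : LExt U N (n + 1)),
      infl U N (n + 1) w = 0 →
        ∃ (V : OpenNormalSubgroup Γ) (h : (V : Subgroup Γ) ≤ U), step U V h N (n + 1) w = 0)
    (M : DiscreteRepCat k Γ) (U : OpenNormalSubgroup Γ) (y : LExt U M (n + 1 + 1))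
    (hy : infl U M (n + 1 + 1) y = 0) :
    ∃ (V : OpenNormalSubgroup Γ) (h : (V : Subgroup Γ) ≤ U), step U V h M (n + 1 + 1) y = 0 := by
  haveI := injective_layer_X₂ M (U : Subgroup Γ) (coe_isOpen U)
  have hy0 : y.comp (Ext.mk₀ (layerSC M (U : Subgroup Γ)).f) (add_zero (n + 1 + 1)) = 0 :=
    Ext.eq_zero_of_injective _
  obtain ⟨w', rfl⟩ := Ext.covariant_sequence_exact₁ (hS := layerSC_shortExact M (U : Subgroup Γ)) _ y
    hy0 (rfl : n + 1 + 1 = n + 1 + 1)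
  rw [infl_comp_extClass] at hy
  obtain ⟨v, hv⟩ := Ext.covariant_sequence_exact₃ (hS := presSC_shortExact M) _ _ rfl hy
  rw [Ext.eq_zero_of_injective v, Ext.zero_comp] at hv
  -- induction hypothesis on `Q` for the class `w' ≫ incl`
  obtain ⟨V, hVU, hV⟩ := ih (presQ M) U
    (w'.comp (Ext.mk₀ (liftableIncl M (U : Subgroup Γ) (U : Subgroup Γ))) (add_zero (n + 1))) hv.symm
  -- at the layer `V`, the class `resX₃ w'` dies in `Q^V`
  have hw₂ : (resX₃ M U V hVU w').comp
      (Ext.mk₀ (liftableIncl M (V : Subgroup Γ) (V : Subgroup Γ))) (add_zero (n + 1)) = 0 := by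
    rw [resX₃_comp_incl]
    exact hV
  -- hence in `liftable M V W₂` for some `W₂ ≤ V`
  obtain ⟨W₂, hW₂V, hW₂⟩ := exists_liftableMono_eq_zero M V (n + 1) V (resX₃ M U V hVU w') hw₂
  refine ⟨W₂, hW₂V.trans hVU, ?_⟩
  rw [← extInfStep_extInfStep M (U : Subgroup Γ) (V : Subgroup Γ) (W₂ : Subgroup Γ) hVU hW₂V]
  change step V W₂ hW₂V M (n + 1 + 1) (step U V hVU M (n + 1 + 1) _) = 0
  rw [step_comp_extClass M U V hVU w', step_comp_extClass M V W₂ hW₂V, resX₃_eq M V W₂ hW₂V, hW₂,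
    toLayerX₃_zero, Ext.zero_comp]

/-! ## §4 The colimit theorem -/

/-- **SURJECTIVITY: every class of `Extⁿ_{C_Γ}(k, M)` is inflated from a finite layer** — for every
`x ∈ Extⁿ_{C_Γ}(triv k, M)` there are an open normal subgroup `U` and `y ∈ Extⁿ_{Rep k (Γ⧸U)}(k, M^U)`
with `extInf_U y = x` (`Γ` profinite). [cite: SerreGaloisCohomology1997, I §2.2 Proposition 8][cite: Harari2020, §4.3 Proposition 4.18, Remark 4.24] -/
theorem exists_infl_eq : ∀ (n : ℕ) (M : DiscreteRepCat k Γ) (x : Ext (triv (Γ := Γ) k) M n),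
    ∃ (U : OpenNormalSubgroup Γ) (y : LExt U M n), infl U M n y = x
  | 0, M, x => by
    obtain ⟨y, hy⟩ := exists_extInf_eq_of_zero ((topOpenNormalSubgroup Γ : OpenNormalSubgroup Γ) :
      Subgroup Γ) (coe_isOpen _) M x
    exact ⟨topOpenNormalSubgroup Γ, y, hy⟩
  | n + 1, M, x => exists_infl_eq_succ n (exists_infl_eq n) M x

/-- Injectivity in positive degrees (induction). [cite: SerreGaloisCohomology1997, I §2.2 Proposition 8] -/
theorem exists_step_eq_zero_succ : ∀ (n : ℕ) (M : DiscreteRepCat k Γ) (U : OpenNormalSubgroup Γ)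
    (y : LExt U M (n + 1)), infl U M (n + 1) y = 0 →
      ∃ (V : OpenNormalSubgroup Γ) (h : (V : Subgroup Γ) ≤ U), step U V h M (n + 1) y = 0
  | 0, M, U, y, hy => ⟨U, le_rfl, by rw [infl_one_injective M U y hy, map_zero]⟩
  | n + 1, M, U, y, hy => exists_step_eq_zero_succ_succ n (exists_step_eq_zero_succ n) M U y hy

/-- **INJECTIVITY: a layer class that dies in `Extⁿ_{C_Γ}(k, M)` dies at a deeper layer** — if
`extInf_U y = 0` then `extInfStep U V y = 0` for some open normal `V ≤ U` (in degrees `0` and `1` even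
`y = 0`: `extInf_zero_injective`, `injective_infl_one`). [cite: SerreGaloisCohomology1997, I §2.2 Proposition 8][cite: Harari2020, §4.3 Proposition 4.18, Remark 4.24] -/
theorem exists_step_eq_zero (n : ℕ) (M : DiscreteRepCat k Γ) (U : OpenNormalSubgroup Γ)
    (y : LExt U M n) (hy : infl U M n y = 0) :
    ∃ (V : OpenNormalSubgroup Γ) (h : (V : Subgroup Γ) ≤ U), step U V h M n y = 0 := by
  cases n with
  | zero =>
    refine ⟨U, le_rfl, ?_⟩
    rw [(injective_iff_map_eq_zero _).1 (extInf_zero_injective (U : Subgroup Γ) (coe_isOpen U) M) y hy,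
      map_zero]
  | succ n => exact exists_step_eq_zero_succ n M U y hy

/-- **Two layer classes with the same inflation agree at a deeper layer.**
[cite: SerreGaloisCohomology1997, I §2.2 Proposition 8] -/
theorem exists_step_eq_step (n : ℕ) (M : DiscreteRepCat k Γ) (U : OpenNormalSubgroup Γ)
    (y y' : LExt U M n) (h : infl U M n y = infl U M n y') :
    ∃ (V : OpenNormalSubgroup Γ) (hVU : (V : Subgroup Γ) ≤ U),
      step U V hVU M n y = step U V hVU M n y' := by
  obtain ⟨V, hVU, hV⟩ := exists_step_eq_zero n M U (y - y') (by rw [map_sub, h, sub_self])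
  exact ⟨V, hVU, sub_eq_zero.1 (by rw [← map_sub, hV])⟩

/-- **VANISHING TRANSFER (the shape of Milne I Lemma 1.9 (b) / Harari Lemma 16.20): if every layer
class dies at some deeper layer, then `Extⁿ_{C_Γ}(k, M) = 0`.**
[cite: SerreGaloisCohomology1997, I §2.2 Proposition 8][cite: Harari2020, §16.3 Lemma 16.20 (p. 276)] -/
theorem ext_eq_zero_of_forall_exists_step_eq_zero (n : ℕ) (M : DiscreteRepCat k Γ)
    (h : ∀ (U : OpenNormalSubgroup Γ) (y : LExt U M n),
      ∃ (V : OpenNormalSubgroup Γ) (hVU : (V : Subgroup Γ) ≤ U), step U V hVU M n y = 0)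
    (x : Ext (triv (Γ := Γ) k) M n) : x = 0 := by
  obtain ⟨U, y, rfl⟩ := exists_infl_eq n M x
  obtain ⟨V, hVU, hV⟩ := h U y
  rw [← extInf_extInfStep (U : Subgroup Γ) (V : Subgroup Γ) (coe_isOpen U) (coe_isOpen V) hVU M n y]
  change infl V M n (step U V hVU M n y) = 0
  rw [hV, map_zero]

end LayerColimit

end DiscreteRep

end Literature.Algebra.Homology
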